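import Summits.QuantumFields.YangMills.Theorems.BalabanUVNodesN07Prop8StepTokenOfRecordOfLettersSym152EG
import Summits.QuantumFields.YangMills.Theorems.BalabanUVNodesN07SplitClauseHeadKnitMeetNormalisedTowerW152EB
import Summits.QuantumFields.YangMills.Theorems.BalabanUVNodesN07ChartMeetNorm77OfLettersSym152EB
import Summits.QuantumFields.YangMills.Theorems.BalabanUVNodesN07Thm4RecordStructureSym152PhiEGB
import Summits.QuantumFields.YangMills.Theorems.BalabanUVNodesK0HalvingStepOfCoreB
import HarnessLib

/-!
# N07 [B11] (= [15] = [Balaban1985Variational]) Sect. F, S6 HEAD — **MODULE 122 AT PRINT's [II] (2.3) DATUM AND PRINT's (7) DATA, WITHOUT THE SEAM** (S1c of the (E1)∕(iii-b) work plan,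
# director-ym №338∕№339; FLAG №16; LOCATE-HSEAM 5d3298b8d191f169): `…Prop8StepTokenOfRecordOfLettersSym152EG` with (i) the conclusion `Prop8RegSepTopStepGB F N suppDom Adm (lamDatum F)
# (dataSmall7LamTopOf F N) B₃ a₀ a₁`, (ii) the (c′)∕(d′)-Lam binders' data row `dataSmall7LamTopOf F N K s.Ω (suppDom) k δ W` and (c′)'s fibre rows at `lamDatum F`, (iii) the HSEAM
# binder ABSENT; everything else — structural letters, guard implications, `hT : HThm4RecSym152PhiEG …` (datum-free, CONDITIONAL), closers' smallness letters, `β₁ ∕ t₁`, HLETTERS,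
# HBUDGET — byte-identical

Cell `pub-ymgap`, seat `pub-ymgap-dag-n07-e` g34 (FAN-OUT §N07 row s3; LANE OWNER of the K0 road chart side).  `--kind proof --supports stmt-QuantumFields-20541 --as helper` (K0⁷); count-neutral;
def-free; ONE theorem.  PRINT-DATUM TWIN of `…N07Prop8StepTokenOfRecordOfLettersSym152EG.prop8RegSepTopStepG_of_hThm4RecSym152EG_of_letters` (FLAG №16 ∕ LOCATE-HSEAM 5d3298b8d191f169); the
(b)-instance stays landed and true on its own text (a conditional displaying HSEAM; cf. `not_hseam` ✓p765776).  HONESTY GUARD №338 (5): no displayed premise is deleted or weakened OTHER THAN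
the HSEAM binder, which the datum change makes definitionally redundant (at `bd := lamDatum F` the knit's fibre rows ARE the agreement on [II] (2.3)'s cells «Λ_j = Ω_j^{(j)} ∖ Ω_{j+1}^{(j)} … for
the sets of sites and the sets of bonds» (p. 224; ruling (α): the DIFFERENCE of the bond sets — inward connectors belong to no `Λ_j`) and print's cell-form criticality there — 77c⁵′ᴮ p766698
derives them); two rows are RE-KEYED to print's objects (`dataSmall7LamTopOf`, P0 ✓p766390; `lamDatum`, F0c ✓p765717).  [15] = [Balaban1985Variational]; [6] = [Balaban1985RegularSpaces];
[II] = [Balaban1984PropagatorsII]; [III] = [Balaban1988Convergent]; [I] = [Balaban1987RG1].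

ASSEMBLY (by name, all landed or filed by this seat today): 77c⁵′ᴮ `datumGaugeSplitTopStepCoreGB_of_normalisedGauge_of_chartMeetTowerW152EB` at `Dat := dataSmall7LamTopOf F N`; HS3NORM-152 :=
S1c-1 ✓p765894 `hS3NORMSym152PhiE_of_hThm4RecSym152PhiEG_B (lamDatum F) (dataSmall7LamTopOf F N)` from `hT`; HCHART-152 := 89⁵′ ✓p766239 `chartMeetNorm77_of_letters_sym152EB` from `hQnear ∕ hA1L`;
HLETTERS ∕ HBUDGET as in 122 (`β₂ := κ·L·ε_j`, `s′ := 0`, MODULE 83's `exists_thresholds_of_budget_lt`); and the (2.3)-datum CORE-TO-TOP link `K0HalvingStepOfCoreB.prop8RegSepTopStepGB_of_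
datumGaugeSplitCoreGB_lam` (core token at print's level-0 exclusion `lamPlaqs0Of F`; its two guard letters `k ≤ m + K` and the grid numerics are read off `hAdm₁ ∕ hAdm₂`) in place of
`K0HalvingStepOfCoreGuardedChain.prop8RegSepTopStepG_of_datumGaugeSplitCoreG`.
HONEST SCOPE.  By-name composition; `HThm4RecSym152PhiEG` CONDITIONAL (N05's (B′) road + the cross-term bound, director №311a (β)); (c′) and (d′)-Lam displayed, NOT discharged here (their
(2.3)-datum suppliers: 99″ᴮ `…SymHQnearB` and 117′ᴮ ✓p766391); NO stub registered or closed; K0⁷ ∕ K1⁹ NOT closed; N07 NOT discharged; counts unmoved (typed 28∕28 · discharged 8∕28); one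
finite 𝕋⁴ programme at fixed ε — the route closes the conditional finite-𝕋⁴ rung `BalabanLadder.UV` ONLY; the YM mass gap (Clay) is NOT proved by any of this; nothing continuum ∕ ℝ⁴ ∕ OS.
No `sorry` ∕ `def` ∕ `instance` ∕ `notation`.

References: [15] (144) p. 300, (147)–(153) p. 301, (154)–(159) pp. 302–303, (160)–(168) pp. 303–304, (7) p. 278, Prop. 8 p. 304; [6] Thm. 2 p. 83, Thm. 4 p. 88, Prop. 6 (1.130)–(1.138)
pp. 98–99, (1.29) p. 81, (1.131) p. 99; [II] (2.1)–(2.4) p. 224, (2.35) p. 228; [III] (2.2) p. 255, (2.10) p. 256; [I] (0.1) p. 251, (0.4) p. 253.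
-/


set_option autoImplicit false

noncomputable section
open scoped BigOperators Matrix.Norms.L2Operator

namespace Summit.QuantumFields.YangMills.BalabanUVNodes.N07Prop8StepTokenOfRecordOfLettersSym152EGB

open Literature.MathematicalPhysics.QuantumFieldTheory.Balaban1983to89
open Literature.MathematicalPhysics.QuantumFieldTheory.Balaban1983to89.Node00
open Literature.MathematicalPhysics.QuantumFieldTheory.Balaban1983to89.B15DeterminingSets
open Literature.MathematicalPhysics.QuantumFieldTheory.Balaban1983to89.B15DeterminingSetsB
open Literature.MathematicalPhysics.QuantumFieldTheory.Balaban1983to89.B12RegularSpaces111 (gaugeU expI grad)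
open LatticeFieldCalculus (bondAvgIter)
open B15Eq112TorusCover (cover)
open B14DomainGeom (Pt Within)
open B5Eq117TorusCarriers (Mk)
open B5Eq118OneStroke (iterBlockOf)
open B5Prop12FieldsLattice (distSite)
open B8Eq131Cubes (sqLo sqHi box cube)
open B11Eq115Space (levOf)
open B6SectADomainsV1 (Domains)
open B6SectAOperatorsV1 (BondIdx RE dsE QpE)
open Literature.MathematicalPhysics.QuantumFieldTheory.BalabanImbrieJaffe1984to88.BIJ85AxialPropagator411 (BondSpace)
open T4Continuum (T4Family)
open T4AxialGaugeSmallField (castSite)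
open GaugeField (gaugeAct)
open Summit.QuantumFields.YangMills.Theorems.K0FlatCubeOpsTextP (flatH)
open Summit.QuantumFields.YangMills.BalabanUVNodes.N07HalvingStepTopOfLocalLetters (Letters10On)
open Summit.QuantumFields.YangMills.BalabanUVNodes.N07Thm4RecordStructureSym152Phi (NrmSymPhiOfRecord)
open Summit.QuantumFields.YangMills.BalabanUVNodes.N07Thm4RecordStructureSym152PhiEG (HThm4RecSym152PhiEG)
open Summit.QuantumFields.YangMills.BalabanUVNodes.N07Thm4RecordStructureSym152PhiEGB (hS3NORMSym152PhiE_of_hThm4RecSym152PhiEG_B)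
open Summit.QuantumFields.YangMills.BalabanUVNodes.N07ChartMeetNorm77OfLettersSym152EB (chartMeetNorm77_of_letters_sym152EB)
open Summit.QuantumFields.YangMills.BalabanUVNodes.N07Prop8StepTokenOfRecordOfLetters (exists_thresholds_of_budget_lt)
open Summit.QuantumFields.YangMills.Theorems.K0HalvingStepOfCoreB (prop8RegSepTopStepGB_of_datumGaugeSplitCoreGB_lam)
open Summit.QuantumFields.YangMills.BalabanUVNodes.N07SplitClauseHeadKnitMeetNormalisedTowerW152EB (datumGaugeSplitTopStepCoreGB_of_normalisedGauge_of_chartMeetTowerW152EB)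

/-! ## §1  The budget's two thresholds: MODULE 83's `exists_thresholds_of_budget_lt`, imported by name -/

/-! ## §2  The guarded [15] Prop. 8 step token of record from `HThm4Rec`, (c′), (d′) and the closed-form budget row -/

open scoped Classical in
/-- ★★★ **THE GUARDED [15] PROP. 8 STEP TOKEN OF RECORD, END TO END, AT PRINT's [II] (2.3) DATUM AND PRINT's (7) DATA — NO SEAM** (print-datum twin of
`prop8RegSepTopStepG_of_hThm4RecSym152EG_of_letters` (FLAG №16 ∕ LOCATE-HSEAM 5d3298b8d191f169); the (b)-instance stays landed and true on its own text): from 122's structural ∕ token ∕ budget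
letters, the ONE CONDITIONAL PREMISE `hT : HThm4RecSym152PhiEG F N Mc ρ (L·Mh) κ a₀ Ψ` (datum-free), (c′) `hQnear` and (d′)-Lam `hA1L` — both now with the data row `dataSmall7LamTopOf F N K s.Ω …`
and (for `hQnear`) the fibre rows `AgreeOnB (lamDatum F K k s.Ω) (Ū U) W → IsCritOnFibreB F N K (lamDatum F K k s.Ω) W U` — the token `Prop8RegSepTopStepGB F N suppDom Adm (lamDatum F)
(dataSmall7LamTopOf F N) B₃ a₀ a₁` for EVERY guard `Adm` implying the V20-G conjuncts and the run's grid numerics.  122's HSEAM binder is ABSENT (at `lamDatum` its content is the fibre rows,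
77c⁵′ᴮ derives it).  Proof: 77c⁵′ᴮ at `Dat := dataSmall7LamTopOf F N`, HS3NORM-152 := the S1c-1 door `hS3NORMSym152PhiE_of_hThm4RecSym152PhiEG_B (lamDatum F) (dataSmall7LamTopOf F N)`,
HCHART-152 := 89⁵′, thresholds := MODULE 83 §1, core-to-top := `K0HalvingStepOfCoreB.prop8RegSepTopStepGB_of_datumGaugeSplitCoreGB_lam` (core at `Ex0 := lamPlaqs0Of F`; the guard's
standing range and grid numerics feed its 1-block saturation of `Ω₁`).
[cite: Balaban1985Variational, Prop. 8 p.304, (144) p.300, (147)–(153) p.301, (154)–(159) pp.302–303, (160)–(168) pp.303–304, (7) p.278; Balaban1985RegularSpaces, Thm. 4 p.88, Prop. 6 (1.130)–(1.138) p.99, (1.29) p.81, (1.131) p.99; Balaban1984PropagatorsII, (2.1)–(2.4) p.224, (2.35) p.228; Balaban1987RG1, (0.1) p.251, (0.4) p.253] -/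
theorem prop8RegSepTopStepGB_of_hThm4RecSym152EG_of_lettersB (F : T4Family) (N : ℕ) [NeZero N] :
    ∃ (Mh₀ R₀ : ℕ) (CH δH BH : ℝ), 0 ≤ CH ∧ 0 < δH ∧ 0 < BH ∧
    ∀ {ρ : ℕ}
      -- structural letters (77c): grid cube `Mc`, block height `a′` (`M_h = L^{a′} ≥ M_h⁰`), `R ≥ R₀`, the collar `ρ` with `L·M_h ∣ ρ`, `R·L·M_h ≤ ρ`, `L ≤ ρ`
      {Mc Mh R a' : ℕ} (_ : 1 ≤ Mc) (_ : Mc ≤ ρ) (_ : Mh = F.L ^ a') (_ : Mh₀ ≤ Mh) (_ : R₀ ≤ R) (_ : F.L * Mh ∣ ρ) (_ : R * (F.L * Mh) ≤ ρ) (hLρ : F.L ≤ ρ)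
      -- the two constants of the plan's V20-G guard `c ≤ ν.M₁ ∧ k + c₀ ≤ F.m + K` and their side conditions (77c ∕ FILE D)
      {c c₀ : ℕ} (_ : (11 * 4 + 4 * ρ + Mc + 3) * F.L ≤ c) (_ : Mc + 11 * 4 + 6 * ρ ≤ 2 * F.L ^ c₀) (_ : F.m ≤ c₀) (_ : a' + 3 ≤ c₀)
      -- ★ THE GUARD: any step guard implying the V20-G conjuncts AND the run's grid numerics the meet's (2.1) needs (`hgran`, `hdiv`)
      (Adm : StepGuard F) (_ : ∀ (ν : Stage7Numerics) (M : ℕ) (g : ℕ → ℝ) (K k : ℕ) (s : SeqOfRecord F ν M g K k), Adm ν M g K k s → c ≤ ν.M₁ ∧ k + c₀ ≤ F.m + K)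
      (_ : ∀ (ν : Stage7Numerics) (M : ℕ) (g : ℕ → ℝ) (K k : ℕ) (s : SeqOfRecord F ν M g K k), Adm ν M g K k s → ∀ j : ℕ, 1 ≤ j → j ≤ k →
        F.L * Mh ∣ M * RkOfRecord (F.P K).L ν.r (g j) ∧ dCubeSide (F.P K).L M (RkOfRecord (F.P K).L ν.r (g j)) j ∣ (F.P K).sitesPerDir 0)
      -- the token's letters, `0 < B₃`, the (152)-letter `κ`, NOW POSITIVE (the door's guard)
      {B₃ C θ Q κ a₀ a₁ : ℝ} {Ψ : (ℕ → ℝ) → ℕ → ℝ} (_ : 0 < B₃) (_ : 0 ≤ C) (_ : 0 ≤ θ) (_ : 0 ≤ Q) (_ : 0 < κ)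
      -- V19's floor `2L² ≤ B₃` and the (162)–(166♭) smallness letters of the closers
      (_ : 2 * (F.L : ℝ) ^ 2 ≤ B₃) (_ : 4 * C ≤ B₃) (_ : 16 * θ ≤ 1) (_ : (16 * Q + 1024 * κ ^ 2) * a₀ ≤ 1) (_ : 32 * κ * a₀ ≤ 1)
      -- the chart side's TWO remaining PER-LEVEL SIZE LETTERS: (c′)'s near-row letter `β₁`, (d′)'s (158) letter `t₁`
      (β₁ t₁ : (ℕ → ℝ) → (ℕ → ℝ) → ℕ → ℝ)
      -- ★ HLETTERS of record (RANGED): the sign of `β₁` only (`β₂ = κ·L·ε_j ≥ 0` and `s′ = 0` are automatic)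
      (_ : ∀ (ε δ : ℕ → ℝ) (j : ℕ), 0 < δ j → δ j ≤ a₁ → B₃ * δ j ≤ ε j → ε j ≤ a₀ → 0 ≤ β₁ ε δ j)
      -- ★ HBUDGET of record (RANGED, CLOSED FORM): 77c's HBUDGET-NORM at `β₂ := κ·L·ε_j`, `s′ := 0`, `θ_H := 8C_H B_H e^{−δ_H ρ}`
      (_ : ∀ (K : ℕ) (ε δ : ℕ → ℝ) (j : ℕ), 0 < δ j → δ j ≤ a₁ → B₃ * δ j ≤ ε j → ε j ≤ a₀ →
        t₁ ε δ j + 1 / 4 * ((sideP (F.P K) Mc ρ : ℕ) : ℝ) *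
            max (4 * CH * BH * β₁ ε δ j) (8 * CH * BH * Real.exp (-(δH * (ρ : ℝ))) * (κ * (F.L : ℝ) * ε j)) <
          C * δ j + θ * ε j + Q * ε j ^ 2)
      -- ★ THE ONE CONDITIONAL PREMISE, GUARD EDITION (c-ii)‴ (candidate (β′), plan g94 WORD (B)): [6] Thm. 4 ∕ Prop. 6 with (152)–(153) and «ū = 1 on Λ′» at data carrying the grid letters at modulus `L·Mh`
      (hT : HThm4RecSym152PhiEG F N Mc ρ (F.L * Mh) κ a₀ Ψ)
      -- ★ (c′) THE NEAR ROWS OF THE BLOCK AVERAGES `QA` on MODULE 77's near class — displayed, NOT discharged (MODULE 80's data rows + print's (156) linearisation; n07-w6 lineage) — 82b's text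
      (hQnear :
        ∀ (ν : Stage7Numerics) (M : ℕ) (g : ℕ → ℝ) (K k : ℕ) (s : SeqOfRecord F ν M g K k), Sect2.SeqSeparated ν.M₁ s → 0 < ν.M₁ →
          Adm ν M g K k s → 1 ≤ k →
          ∀ (ε δ : ℕ → ℝ),
          (∀ n, n ≤ k → 0 < δ n ∧ δ n ≤ a₁) → (∀ n, n < k → δ n ≤ 2 * δ (n + 1)) → (∀ n, n < k → δ (n + 1) ≤ 2 * δ n) →
          (∀ n, n ≤ k → B₃ * δ n ≤ ε n ∧ ε n ≤ a₀) → (∀ n, n < k → ε n ≤ 2 * ε (n + 1)) → (∀ n, n < k → ε (n + 1) ≤ 2 * ε n) →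
          ∀ W : MSField (F.P K) (SU N), dataSmall7LamTopOf F N K s.Ω (suppDomOfRecord F ν K s.Ω) k δ W →
          ∀ U : GaugeField (F.P K) 0 (SU N),
          (∀ n, n ≤ k → PlaqSmallOn (Sect2.omegaPlaqsTop s.Ω (suppDomOfRecord F ν K s.Ω) n) (ε n * (F.P K).eta n ^ 2) U) →
          (∀ n, n ≤ k → Sect2.CoDivSmallOn (Sect2.omegaBondsTop s.Ω (suppDomOfRecord F ν K s.Ω) n) (ε n * (F.P K).eta n ^ 3) U) →
          AgreeOnB (lamDatum F K k s.Ω) (avgFamily (avOfRecord F N K) U) W → IsCritOnFibreB F N K (lamDatum F K k s.Ω) W U →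
          ∀ (n : ℕ) (hk : K - n ≤ (F.P K).m + (F.P K).K), 1 ≤ K - n → K - n ≤ k → ∀ (idx : Pt (F.P K).d),
          -- MEETING DATUMS ONLY: the print box has a point within `3` of a lift of a site of `Ω_{K−n}`
          (∃ x ∈ box (F.P K).L (cornerP (F.P K) Mc ρ idx) (sideP (F.P K) Mc ρ) (K - n), ∃ y : Pt (F.P K).d, cover (F.P K) y ∈ s.Ω (K - n) ∧ Within ((3 : ℕ) : ℤ) x y) →
          -- PRINT-MARGIN-CLEAN DATUMS ONLY (print p. 300 + (144)'s margin cube «□̃» = the print box WIDENED BY `2ρ` BLOCKS): top level, or «□̃» misses `Ω_{j+1}`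
          (K - n = k ∨ ∀ z ∈ box (F.P K).L (cornerP (F.P K) Mc ρ idx - ((2 * ρ : ℕ) : Pt (F.P K).d)) (sideP (F.P K) Mc ρ + 2 * (2 * ρ)) (K - n),
            cover (F.P K) z ∉ s.Ω (K - n + 1)) →
          -- THE FAMILY: print's (150) `Ω′_j = □_j (j < k), Ω′_k = □_k ∩ Ω_k`
          ∀ {HVd : Domains (F.P K)}
            (_ : HVd = domainsMeet (cubeDomains (F.P K) (cornerP (F.P K) Mc ρ idx) (sideP (F.P K) Mc ρ) ρ (K - n) hk) (domainsOfSeq s.Ω (K - n) hk))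
            (lo hi : ℕ → Pt (F.P K).d),
          lo 0 = (fun i => ((F.P K).L : ℤ) * (sqLo (F.P K).L (cornerP (F.P K) Mc ρ idx) ρ (K - n) 1 i - 1)) →
          hi 0 = (fun i => ((F.P K).L : ℤ) * (sqHi (F.P K).L (cornerP (F.P K) Mc ρ idx) (sideP (F.P K) Mc ρ) ρ (K - n) 1 i + 1) + (((F.P K).L : ℤ) - 1)) →
          (∀ j', 1 ≤ j' → lo j' = sqLo (F.P K).L (cornerP (F.P K) Mc ρ idx) ρ (K - n) j' - 1) →
          (∀ j', 1 ≤ j' → hi j' = sqHi (F.P K).L (cornerP (F.P K) Mc ρ idx) (sideP (F.P K) Mc ρ) ρ (K - n) j' + 1) →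
          ∀ (u : GaugeTransf (F.P K) 0 (SU N)) (A : PBond (F.P K) 0 → MatA N),
          (∀ b ∈ (Sect2.regionOfSet (F.P K) (cover (F.P K) '' box (F.P K).L (cornerP (F.P K) Mc ρ idx) (sideP (F.P K) Mc ρ) (K - n))).bonds,
            gaugeU (fun x => ιSU N (u x)) (fun b' => ιSU N (U b')) b = expI ((F.P K).eta (K - n)) (A b)) →
          -- (T1) the gauge equation on the WHOLE TOWER `□₀` of the datum
          (∀ b ∈ (Sect2.regionOfSet (F.P K) (cover (F.P K) '' cube (F.P K).L (cornerP (F.P K) Mc ρ idx) (sideP (F.P K) Mc ρ) ρ (K - n) 0)).bonds,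
            gaugeU (fun x => ιSU N (u x)) (fun b' => ιSU N (U b')) b = expI ((F.P K).eta (K - n)) (A b)) →
          -- (T2) (152)'s LEVEL-WEIGHTED letters on every `□_{j′}`, `j′ ≤ K − n`
          (∀ j', j' ≤ K - n →
            ∀ b ∈ (Sect2.regionOfSet (F.P K) (cover (F.P K) '' cube (F.P K).L (cornerP (F.P K) Mc ρ idx) (sideP (F.P K) Mc ρ) ρ (K - n) j')).bonds,
              ‖A b‖ < κ * ε (K - n) * ((F.P K).L : ℝ) ^ (K - n - j')) →
          (∀ b ∈ (Sect2.regionOfSet (F.P K) (cover (F.P K) '' box (F.P K).L (cornerP (F.P K) Mc ρ idx) (sideP (F.P K) Mc ρ) (K - n))).bonds,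
            ‖A b‖ < κ * ε (K - n)) →
          (∀ q ∈ (Sect2.regionOfSet (F.P K) (cover (F.P K) '' box (F.P K).L (cornerP (F.P K) Mc ρ idx) (sideP (F.P K) Mc ρ) (K - n))).dpairs,
            ‖grad ((F.P K).eta (K - n)) q.2.1 (fun y => A ⟨y, q.2.2⟩) q.1‖ < κ * ε (K - n)) →
          (∀ b ∈ Sect2.bondsDeep (cover (F.P K) '' box (F.P K).L (cornerP (F.P K) Mc ρ idx) (sideP (F.P K) Mc ρ) (K - n)),
            ‖Sect2.codiffCurlA ((F.P K).eta (K - n)) A b.src b.dir‖ < κ * ε (K - n)) →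
          (∀ b ∈ Sect2.bondsDeep (cover (F.P K) '' box (F.P K).L (cornerP (F.P K) Mc ρ idx) (sideP (F.P K) Mc ρ) (K - n)),
            ‖∑ ν' : Fin (F.P K).d, (((F.P K).eta (K - n) : ℝ) : ℂ)⁻¹ •
                (grad ((F.P K).eta (K - n)) ν' (fun y => A ⟨y, b.dir⟩) (b.src.unshift ν') - grad ((F.P K).eta (K - n)) ν' (fun y => A ⟨y, b.dir⟩) b.src)‖ <
              κ * ε (K - n)) →
          (∀ D' : Domains (F.P K), LinearMap.ker (QpE D') ≤ LinearMap.ker (QpE HVd) → ∀ φ : MatA N →L[ℂ] ℂ,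
            RE D' ((F.P K).eta (K - n))⁻¹ (dsE ((F.P K).eta (K - n))⁻¹ (WithLp.toLp 2 fun b => (φ (A b)).re : BondSpace (F.P K))) = 0 ∧
            RE D' ((F.P K).eta (K - n))⁻¹ (dsE ((F.P K).eta (K - n))⁻¹ (WithLp.toLp 2 fun b => (φ (A b)).im : BondSpace (F.P K))) = 0) →
          -- ★ THE NORMALISATION of this `u` (print's «ū_j = 1 on Λ′_j»), as delivered by HS3NORM
          NrmSymPhiOfRecord F N Mc ρ (Ψ ε (K - n)) ν M g K k s U (K - n) idx u A →
          ∀ c : BondIdx HVd, ((c.1.1 : ℕ) = K - n ∨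
              (blockOf c.1.2.src ∈ (cubeDomains (F.P K) (cornerP (F.P K) Mc ρ idx) (sideP (F.P K) Mc ρ) ρ (K - n) hk).Om ((c.1.1 : ℕ) + 1) ∧
                blockOf c.1.2.tgt ∈ (cubeDomains (F.P K) (cornerP (F.P K) Mc ρ idx) (sideP (F.P K) Mc ρ) ρ (K - n) hk).Om ((c.1.1 : ℕ) + 1))) →
            ‖bondAvgIter (c.1.1 : ℕ) A c.1.2‖ ≤ β₁ ε δ (K - n))
      -- ★ (d′) THE (158) LETTERS of `A₁ = A − H_V(𝟙_reach·QA)` — displayed, NOT discharged (k0-s1 S4's line, at MODULE 76's pinned-local `H_V`)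
      -- ★ (d′)-Lam: THE ∀-BODY OF MODULE 117′'s `hA1_lam_free` at the abstract letter `t₁` (NO normalisation binder) — displayed here, DISCHARGED at the head 100⁗
      (hA1L :
        ∀ (ν : Stage7Numerics) (M : ℕ) (g : ℕ → ℝ) (K k : ℕ) (s : SeqOfRecord F ν M g K k), Sect2.SeqSeparated ν.M₁ s → 0 < ν.M₁ →
          Adm ν M g K k s → 1 ≤ k →
          ∀ (ε δ : ℕ → ℝ),
          (∀ n, n ≤ k → 0 < δ n ∧ δ n ≤ a₁) → (∀ n, n < k → δ n ≤ 2 * δ (n + 1)) → (∀ n, n < k → δ (n + 1) ≤ 2 * δ n) →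
          (∀ n, n ≤ k → B₃ * δ n ≤ ε n ∧ ε n ≤ a₀) → (∀ n, n < k → ε n ≤ 2 * ε (n + 1)) → (∀ n, n < k → ε (n + 1) ≤ 2 * ε n) →
          ∀ W : MSField (F.P K) (SU N), dataSmall7LamTopOf F N K s.Ω (suppDomOfRecord F ν K s.Ω) k δ W →
          ∀ U : GaugeField (F.P K) 0 (SU N),
          (∀ n, n ≤ k → PlaqSmallOn (Sect2.omegaPlaqsTop s.Ω (suppDomOfRecord F ν K s.Ω) n) (ε n * (F.P K).eta n ^ 2) U) →
          (∀ n, n ≤ k → Sect2.CoDivSmallOn (Sect2.omegaBondsTop s.Ω (suppDomOfRecord F ν K s.Ω) n) (ε n * (F.P K).eta n ^ 3) U) →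
          ∀ (hkk : k ≤ (F.P K).m + (F.P K).K),
          (∀ (j : ℕ) (c : PBond (F.P K) j), (domainsOfSeq s.Ω k hkk).LamBond j c → avgFamily (avOfRecord F N K) U j c = W j c) →
          (∀ γ : ℝ → GaugeField (F.P K) 0 (SU N), γ 0 = U →
            DifferentiableAt ℝ (fun (t : ℝ) (b : PBond (F.P K) 0) => ((γ t b : SU N) : Matrix (Fin N) (Fin N) ℂ)) 0 →
              (∀ᶠ t in nhds (0 : ℝ), ∀ (j : ℕ) (c : PBond (F.P K) j), (domainsOfSeq s.Ω k hkk).LamBond j c →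
                avgFamily (avOfRecord F N K) (γ t) j c = W j c) →
                ∀ a : ℝ, HasDerivAt (fun t => wilsonAction4 (γ t)) a 0 → a = 0) →
          ∀ (n : ℕ) (hk : K - n ≤ (F.P K).m + (F.P K).K), 1 ≤ K - n → K - n ≤ k → ∀ (idx : Pt (F.P K).d),
          -- MEETING DATUMS ONLY: the print box has a point within `3` of a lift of a site of `Ω_{K−n}`
          (∃ x ∈ box (F.P K).L (cornerP (F.P K) Mc ρ idx) (sideP (F.P K) Mc ρ) (K - n), ∃ y : Pt (F.P K).d, cover (F.P K) y ∈ s.Ω (K - n) ∧ Within ((3 : ℕ) : ℤ) x y) →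
          -- PRINT-MARGIN-CLEAN DATUMS ONLY (print p. 300 + (144)'s margin cube «□̃» = the print box WIDENED BY `2ρ` BLOCKS): top level, or «□̃» misses `Ω_{j+1}`
          (K - n = k ∨ ∀ z ∈ box (F.P K).L (cornerP (F.P K) Mc ρ idx - ((2 * ρ : ℕ) : Pt (F.P K).d)) (sideP (F.P K) Mc ρ + 2 * (2 * ρ)) (K - n),
            cover (F.P K) z ∉ s.Ω (K - n + 1)) →
          -- THE FAMILY: print's (150) `Ω′_j = □_j (j < k), Ω′_k = □_k ∩ Ω_k`
          ∀ {HVd : Domains (F.P K)}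
            (_ : HVd = domainsMeet (cubeDomains (F.P K) (cornerP (F.P K) Mc ρ idx) (sideP (F.P K) Mc ρ) ρ (K - n) hk) (domainsOfSeq s.Ω (K - n) hk))
            (lo hi : ℕ → Pt (F.P K).d),
          lo 0 = (fun i => ((F.P K).L : ℤ) * (sqLo (F.P K).L (cornerP (F.P K) Mc ρ idx) ρ (K - n) 1 i - 1)) →
          hi 0 = (fun i => ((F.P K).L : ℤ) * (sqHi (F.P K).L (cornerP (F.P K) Mc ρ idx) (sideP (F.P K) Mc ρ) ρ (K - n) 1 i + 1) + (((F.P K).L : ℤ) - 1)) →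
          (∀ j', 1 ≤ j' → lo j' = sqLo (F.P K).L (cornerP (F.P K) Mc ρ idx) ρ (K - n) j' - 1) →
          (∀ j', 1 ≤ j' → hi j' = sqHi (F.P K).L (cornerP (F.P K) Mc ρ idx) (sideP (F.P K) Mc ρ) ρ (K - n) j' + 1) →
          ∀ (HV : (BondIdx HVd → MatA N) →ₗ[ℂ] (PBond (F.P K) 0 → MatA N)),
            (∀ (Bf : BondIdx HVd → MatA N) (b : PBond (F.P K) 0), HV Bf b = ∑ c, ((flatH (F.P K) (K - n) HVd (Pi.single c 1) b : ℝ) : ℂ) • Bf c) →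
          ∀ (u : GaugeTransf (F.P K) 0 (SU N)) (A : PBond (F.P K) 0 → MatA N),
          (∀ b ∈ (Sect2.regionOfSet (F.P K) (cover (F.P K) '' box (F.P K).L (cornerP (F.P K) Mc ρ idx) (sideP (F.P K) Mc ρ) (K - n))).bonds,
            gaugeU (fun x => ιSU N (u x)) (fun b' => ιSU N (U b')) b = expI ((F.P K).eta (K - n)) (A b)) →
          -- (T1) the gauge equation on the WHOLE TOWER `□₀` of the datum
          (∀ b ∈ (Sect2.regionOfSet (F.P K) (cover (F.P K) '' cube (F.P K).L (cornerP (F.P K) Mc ρ idx) (sideP (F.P K) Mc ρ) ρ (K - n) 0)).bonds,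
            gaugeU (fun x => ιSU N (u x)) (fun b' => ιSU N (U b')) b = expI ((F.P K).eta (K - n)) (A b)) →
          -- (T2) (152)'s LEVEL-WEIGHTED letters on every `□_{j′}`, `j′ ≤ K − n`
          (∀ j', j' ≤ K - n →
            ∀ b ∈ (Sect2.regionOfSet (F.P K) (cover (F.P K) '' cube (F.P K).L (cornerP (F.P K) Mc ρ idx) (sideP (F.P K) Mc ρ) ρ (K - n) j')).bonds,
              ‖A b‖ < κ * ε (K - n) * ((F.P K).L : ℝ) ^ (K - n - j')) →
          (∀ j', j' ≤ K - n →
            ∀ q ∈ (Sect2.regionOfSet (F.P K) (cover (F.P K) '' cube (F.P K).L (cornerP (F.P K) Mc ρ idx) (sideP (F.P K) Mc ρ) ρ (K - n) j')).dpairs,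
              ‖grad ((F.P K).eta (K - n)) q.2.1 (fun y => A ⟨y, q.2.2⟩) q.1‖ < κ * ε (K - n) * ((F.P K).L : ℝ) ^ (2 * (K - n - j'))) →
          (∀ b ∈ (Sect2.regionOfSet (F.P K) (cover (F.P K) '' box (F.P K).L (cornerP (F.P K) Mc ρ idx) (sideP (F.P K) Mc ρ) (K - n))).bonds,
            ‖A b‖ < κ * ε (K - n)) →
          (∀ q ∈ (Sect2.regionOfSet (F.P K) (cover (F.P K) '' box (F.P K).L (cornerP (F.P K) Mc ρ idx) (sideP (F.P K) Mc ρ) (K - n))).dpairs,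
            ‖grad ((F.P K).eta (K - n)) q.2.1 (fun y => A ⟨y, q.2.2⟩) q.1‖ < κ * ε (K - n)) →
          (∀ b ∈ Sect2.bondsDeep (cover (F.P K) '' box (F.P K).L (cornerP (F.P K) Mc ρ idx) (sideP (F.P K) Mc ρ) (K - n)),
            ‖Sect2.codiffCurlA ((F.P K).eta (K - n)) A b.src b.dir‖ < κ * ε (K - n)) →
          (∀ b ∈ Sect2.bondsDeep (cover (F.P K) '' box (F.P K).L (cornerP (F.P K) Mc ρ idx) (sideP (F.P K) Mc ρ) (K - n)),
            ‖∑ ν' : Fin (F.P K).d, (((F.P K).eta (K - n) : ℝ) : ℂ)⁻¹ •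
                (grad ((F.P K).eta (K - n)) ν' (fun y => A ⟨y, b.dir⟩) (b.src.unshift ν') - grad ((F.P K).eta (K - n)) ν' (fun y => A ⟨y, b.dir⟩) b.src)‖ <
              κ * ε (K - n)) →
          (∀ D' : Domains (F.P K), LinearMap.ker (QpE D') ≤ LinearMap.ker (QpE HVd) → ∀ φ : MatA N →L[ℂ] ℂ,
            RE D' ((F.P K).eta (K - n))⁻¹ (dsE ((F.P K).eta (K - n))⁻¹ (WithLp.toLp 2 fun b => (φ (A b)).re : BondSpace (F.P K))) = 0 ∧
            RE D' ((F.P K).eta (K - n))⁻¹ (dsE ((F.P K).eta (K - n))⁻¹ (WithLp.toLp 2 fun b => (φ (A b)).im : BondSpace (F.P K))) = 0) →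
          Letters10On (cover (F.P K) '' box (F.P K).L (cornerP (F.P K) Mc ρ idx) (sideP (F.P K) Mc ρ) (K - n)) ((F.P K).eta (K - n)) (t₁ ε δ (K - n))
            (fun b => A b - HV (fun c : BondIdx HVd =>
              if (∀ x : Site (F.P K) 0, (iterBlockOf (c.1.1 : ℕ) x = c.1.2.src ∨ iterBlockOf (c.1.1 : ℕ) x = c.1.2.tgt) →
                  x ∈ cover (F.P K) '' cube (F.P K).L (cornerP (F.P K) Mc ρ idx) (sideP (F.P K) Mc ρ) ρ (K - n) 0)
              then bondAvgIter (c.1.1 : ℕ) A c.1.2 else 0) b)),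
      Prop8RegSepTopStepGB F N (fun ν K Ω => suppDomOfRecord F ν K Ω) Adm (lamDatum F) (dataSmall7LamTopOf F N) B₃ a₀ a₁ := by
  obtain ⟨Mh₀, R₀, CH, δH, BH, hCH, hδH, hBH, hmain⟩ := datumGaugeSplitTopStepCoreGB_of_normalisedGauge_of_chartMeetTowerW152EB F N
  refine ⟨Mh₀, R₀, CH, δH, BH, hCH, hδH, hBH, ?_⟩
  intro ρ Mc Mh R a' hMc hMcρ hMha hMh hR hdvd hRρ hLρ c c₀ hc hc₀ hmc₀ hac₀ Adm hAdm₁ hAdm₂ B₃ C θ Q κ a₀ a₁ Ψ hB₃ hC0 hθ0 hQ0 hκ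
    hB₃L hC hθ ha hκa β₁ t₁ hβ₁ hbudget hT hQnear hA1L
  -- the letters of record: `β₂ := κ·L·ε_j` (MODULE 78 ∕ 82b), `s′ := 0` (82a's `B′ := 0`), `θ_H := 8 C_H B_H e^{−δ_H ρ}` (77c's floor)
  have hletters : ∀ (ε δ : ℕ → ℝ) (j : ℕ), 0 < δ j → δ j ≤ a₁ → B₃ * δ j ≤ ε j → ε j ≤ a₀ →
      0 ≤ β₁ ε δ j ∧ 0 ≤ (fun (ε : ℕ → ℝ) (_ : ℕ → ℝ) (j : ℕ) => κ * (F.L : ℝ) * ε j) ε δ j ∧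
        0 ≤ (fun (_ : ℕ → ℝ) (_ : ℕ → ℝ) (_ : ℕ) => (0 : ℝ)) ε δ j := by
    intro ε δ j hδ hδa hBδ hεa
    have hεj : 0 ≤ ε j := by nlinarith
    exact ⟨hβ₁ ε δ j hδ hδa hBδ hεa, mul_nonneg (mul_nonneg hκ.le (Nat.cast_nonneg _)) hεj, le_rfl⟩
  have hbudget' : ∀ (K : ℕ) (ε δ : ℕ → ℝ) (j : ℕ), 0 < δ j → δ j ≤ a₁ → B₃ * δ j ≤ ε j → ε j ≤ a₀ → ∃ t₂ t₃ : ℝ,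
      1 / 4 * ((sideP (F.P K) Mc ρ : ℕ) : ℝ) *
          max (4 * CH * BH * β₁ ε δ j)
            (8 * CH * BH * Real.exp (-(δH * (ρ : ℝ))) * (fun (ε : ℕ → ℝ) (_ : ℕ → ℝ) (j : ℕ) => κ * (F.L : ℝ) * ε j) ε δ j) < t₂ ∧
        2 * CH * BH * (fun (_ : ℕ → ℝ) (_ : ℕ → ℝ) (_ : ℕ) => (0 : ℝ)) ε δ j < t₃ ∧
        t₁ ε δ j + t₂ + t₃ < C * δ j + θ * ε j + Q * ε j ^ 2 := by
    intro K ε δ j hδ hδa hBδ hεa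
    obtain ⟨t₂, t₃, ht₂, ht₃, hsum⟩ := exists_thresholds_of_budget_lt (hbudget K ε δ j hδ hδa hBδ hεa)
    exact ⟨t₂, t₃, ht₂, by simpa only [mul_zero] using ht₃, hsum⟩
  -- the guard's standing range and grid numerics, for the (2.3)-datum core-to-top link (1-block saturation of `Ω₁` pins the `Λ₀`-plaquettes)
  have hAdmK : ∀ (ν : Stage7Numerics) (M : ℕ) (g : ℕ → ℝ) (K k : ℕ) (s : SeqOfRecord F ν M g K k), Adm ν M g K k s → k ≤ (F.P K).m + (F.P K).K := by
    intro ν M g K k s h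
    have h2 := (hAdm₁ ν M g K k s h).2
    have : (F.P K).m + (F.P K).K = F.m + K := rfl
    omega
  have hAdmG : ∀ (ν : Stage7Numerics) (M : ℕ) (g : ℕ → ℝ) (K k : ℕ) (s : SeqOfRecord F ν M g K k), Adm ν M g K k s → ∀ j : ℕ, 1 ≤ j → j ≤ k →
      dCubeSide (F.P K).L M (RkOfRecord (F.P K).L ν.r (g j)) j ∣ (F.P K).sitesPerDir 0 := fun ν M g K k s h j h1 hj => (hAdm₂ ν M g K k s h j h1 hj).2
  exact prop8RegSepTopStepGB_of_datumGaugeSplitCoreGB_lam hMc hLρ hAdmK hAdmG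
    (hmain (dataSmall7LamTopOf F N) hMc hMcρ hMha hMh hR hdvd hRρ hLρ hc hc₀ hmc₀ hac₀ Adm hAdm₁ hAdm₂ hB₃ hC0 hθ0 hQ0 hκ.le le_rfl
      β₁ (fun (ε : ℕ → ℝ) (_ : ℕ → ℝ) (j : ℕ) => κ * (F.L : ℝ) * ε j) (fun (_ : ℕ → ℝ) (_ : ℕ → ℝ) (_ : ℕ) => (0 : ℝ)) t₁ hletters hbudget'
      (fun ν M g K k s ε U j idx u A => NrmSymPhiOfRecord F N Mc ρ (Ψ ε j) ν M g K k s U j idx u A)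
      (hS3NORMSym152PhiE_of_hThm4RecSym152PhiEG_B F N (lamDatum F) (dataSmall7LamTopOf F N) hc hc₀ Adm hAdm₁ hAdm₂ hB₃ hκ hT)
      (chartMeetNorm77_of_letters_sym152EB F N (lamDatum F) (dataSmall7LamTopOf F N) hLρ Adm hB₃ hκ.le β₁ (fun (ε : ℕ → ℝ) (_ : ℕ → ℝ) (j : ℕ) => κ * (F.L : ℝ) * ε j)
        (fun (_ : ℕ → ℝ) (_ : ℕ → ℝ) (_ : ℕ) => (0 : ℝ)) t₁ rfl (fun _ _ _ => le_rfl) hQnear hA1L))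
    hB₃L hC hθ hQ0 hκ.le ha hκa

end Summit.QuantumFields.YangMills.BalabanUVNodes.N07Prop8StepTokenOfRecordOfLettersSym152EGB

end
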